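import Summits.BirchSwinnertonDyer.BirchSwinnertonDyer.Theorems.AdditiveKolyvaginRoadLevelSystemsEvenLevels
import Summits.BirchSwinnertonDyer.BirchSwinnertonDyer.Theorems.AdditiveKolyvaginRoadKolyvaginPrimitiveAdditiveRankLowering
import Summits.BirchSwinnertonDyer.BirchSwinnertonDyer.Theorems.AdditiveKolyvaginRoadLevelBasics
import Summits.BirchSwinnertonDyer.BirchSwinnertonDyer.Theorems.AdditiveKolyvaginRoadLevelMembership
import Literature.NumberTheory.NumberFields.CongruenceSubgroupTorsionFree
import HarnessLib

/-!
# Route `AdditiveKolyvaginRoad`, crux `LevelKolyvaginSystemsAdditive` (item stmt-BirchSwinnertonDyer-21396, KS′):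
# the ZHANG-SHAPE DICTIONARY — a level Kolyvagin system from EVEN-LEVEL classes, the SECOND reciprocity law
# (Thm 4.3, cohomological congruence) and the FIRST FLOOR (Thm 7.2's definite-side input), the E-side rank lowering
# (A1) being LANDED
# (cell `pub/bsd-wall`, width seat `bsd-wall-akr-p2x-w3` g0 on line `birth`; `--supports stmt-BirchSwinnertonDyer-21396`, helper;
# the CONGRUENCE-FORM companion of width seat w2's BIPARTITE dictionary `…LevelSystemsEvenLevels` §2 ∕ `…LevelSystemsOfBipartite`)

WHY THIS FILE. The carrier `LevelKolyvaginSystemP` (`Theorems/AdditiveKolyvaginRoadLevelSystems.lean`) states W. Zhang's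
(A2) TRANSPORT and (A5) BASE CASE in the CONSUMER's shape (the contrapositive transport `q₂ ∉ baseLocus(n q₁ q₂) ⇒ ∃ m,
κ(m, n) ≠ 0` used by the §9 induction engine, and `c(1, n) ≠ 0` at even levels of canonical rank one). The lead's carrier
audit (akr-p2x g0, CARRIER-AUDIT 2026-08-27) and the vet (akr3) located the CONTENT of KS′ in exactly these two fields. This
file is the DICTIONARY from the PRODUCER's shape — the statements W. Zhang actually proves (Camb. J. Math. 2 (2014)) — to
those fields, so that a crux-idea line for KS′ knows precisely which objects it owes:

* (SRL) **the second reciprocity law in cohomological-congruence form** (Thm 4.3, (4.3)–(4.5), p. 218: for an even level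
  `n`, admissible `q₁, q₂ ∉ n`, `loc_{q₁} c(m, n) ∈ H¹(K_{q₁}, k)` and `loc_{q₂} c(m, n q₁ q₂) ∈ H¹(K_{q₂}, k(1))` CORRESPOND
  under fixed isomorphisms with `k`, up to a unit) — read as the equivalence of vanishing
  `loc_{v₁} κ(m, n) = 0 ⟺ loc_{v₂} κ(m, n ∪ {q₁, q₂}) = 0` (Bertolini–Darmon's two reciprocity laws + Ihara ∕ multiplicity
  one (4.8) at the DEFINITE level `n q₁`; in print for `p ∤ N`; at `p² ∣ N` the multiplicity-one input is the open (δ)-type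
  ingredient) ⟹ `transport` (`exists_ne_zero_of_reciprocity_of_notMem_baseLocusQP`);
* (FF) **the first floor** = the definite-side half of the proof of Thm 7.2 (pp. 232–234: level raising Thm 2.1 at one
  new admissible `q`, the rank-0 anchor Thm 7.1 «`Sel_{𝔭}(A_{nq}/K) = 0 ⇒ L(g_{nq}/K, 1)/Ω^{can}` is a `p`-unit», Gross's
  formula Cor 6.2 with the period comparison Thm 6.4, and the first reciprocity law Thm 6.5 «`L^{alg}(g_{nq}/K,1) ≢ 0 ⟺
  loc_q c(1, n) ≠ 0`»), packaged as ONE cohomological schema per `(n, q)`: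
  `Sel_{n∪q}^+ = 0 ∧ Sel_{n∪q}^- = 0 ⟹ loc_v κ(∅, n) ≠ 0` for `v ∣ q` — no Brandt-module ∕ `T_𝔪`-eigenspace pin, hence
  clear of the dead multiplicity-one carrier (DEAD-LINES D1, `(5, II*)`); at `p² ∣ N` this IS the unprinted rank-0 anchor (γ)
  + period bridge (δ) of the route's T5 ceiling — together with the LANDED E-side rank lowering (A1)
  `stub_rankLoweringAdditive` (W. Zhang Prop. 5.4 + Lemma 7.3 for the canonical spaces, akr-p1 g2, p521749) ⟹ `baseCase`
  (`ne_zero_of_rankLowering_of_firstFloor`);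
* `nonempty_levelKolyvaginSystemP_of_reciprocity_of_firstFloor` — AT A ♯ ADDITIVE FRAME (the binders of (A1)), for
  complex conjugation `c ≠ 1`: EVEN-level classes `κ₀(m, n)` with the `realisation` identity at `∅` and the Kolyvagin-system
  properties (§8.1 property (1) and (8.1): `sign`, `selmer_off`, `selmer_inf`, `toric_on`, `transverse_on`, `relation`) at
  even non-empty levels, (SRL) from even bottom levels and (FF) at even non-empty levels ⟹
  `Nonempty (LevelKolyvaginSystemP W K p Dt β ι c)` — the conclusion of KS′ at the frame (via the even-levels reduction
  `nonempty_levelKolyvaginSystemP_of_evenLevels`). CERTIFICATE: KS′ ⟸ {Heegner classes on the Shimura curves `X_{N,∏n}`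
  with their Kolyvagin-system properties} ∧ (SRL) ∧ (FF); the E-side (Čebotarev, rank lowering) is in the kernel.

HONEST FRAMING: theorems only; 0 definitions, 0 named facts, 0 `sorry`; every producer-shape statement is an explicit
HYPOTHESIS (binders `reciprocity`, `firstFloor`, the even-level data); closes nothing. BSD is not proved by any of this.

References: [cite: WZhang2014, Thm. 4.3 (4.3)–(4.5), (4.8), Prop. 5.4, Cor. 6.2, Thm. 6.4, Thm. 6.5, Thm. 7.1, Thm. 7.2
(proof, pp. 232–234), Lemma 7.3, Def. 8.3, §9] [cite: BertoliniDarmon2005, Thm. 9.2, Thm. 3.2, §2.2–§2.3]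
[cite: GrossLMS1991, §4 (4.4)].
-/

-- single-conjunct summit: `Summit.BirchSwinnertonDyer.BirchSwinnertonDyer.…` repeats the name by design
set_option linter.dupNamespace false

noncomputable section

open scoped Classical

namespace Summit.BirchSwinnertonDyer.BirchSwinnertonDyer.Theorems.AdditiveKoly

open WeierstrassCurve NumberField IsDedekindDomain
  Literature.NumberTheory.EllipticCurves Literature.NumberTheory.EllipticCurves.ModularForms
  Literature.NumberTheory.EllipticCurves.Rank1Residual Literature.NumberTheory.GaloisRepresentations Module
  Summit.BirchSwinnertonDyer.Rank1Residual.X11b.Three.Koly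

variable (W : WeierstrassCurve ℚ) (K : Type) [Field K] [NumberField K] (p : ℕ) [W.IsGloballyMinimal]

/-! ## §1 `transport` from the second reciprocity law (Thm 4.3 in congruence form) -/

/-- **(A2) TRANSPORT from the cohomological congruence of Heegner points.** For any system of classes `κ m n ∈ H¹(K, E[p])`
indexed by levels `n` (finite sets of admissible primes): IF for the bottom level `n` and two new admissible primes `q₁ ∉ n`,
`q₂ ∉ n ∪ {q₁}` the vanishing of `loc_{v₁} κ(m, n)` at the places `v₁ ∣ q₁` is EQUIVALENT to the vanishing of
`loc_{v₂} κ(m, n ∪ {q₁, q₂})` at the places `v₂ ∣ q₂`, for every conductor `m` (W. Zhang Thm 4.3, (4.5): the two localisations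
agree up to a unit under `H¹(K_{q₁}, k) ≃ k ≃ H¹(K_{q₂}, k(1))`), THEN `q₂` off the base locus of the level `n ∪ {q₁, q₂}` (some
`κ(m, n q₁ q₂)` not locally trivial above `q₂`, Def. 8.3) forces `κ(m, n) ≠ 0` (it is not even locally trivial above `q₁`;
a place above the prime `q₁` exists). This is the field `LevelKolyvaginSystemP.transport` read off Thm 4.3.
[cite: WZhang2014, Thm. 4.3 (4.3)–(4.5), Def. 8.3] -/
theorem exists_ne_zero_of_reciprocity_of_notMem_baseLocusQP {M : Type} (κ : M → Finset (AdmQ W K p) → Vp W K p)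
    {n : Finset (AdmQ W K p)} {q₁ q₂ : AdmQ W K p}
    (hrec : ∀ (m : M) (v₁ v₂ : HeightOneSpectrum (𝓞 K)), ((q₁ : ℕ) : 𝓞 K) ∈ v₁.asIdeal →
      ((q₂ : ℕ) : 𝓞 K) ∈ v₂.asIdeal →
      (κ m n ∈ (W.baseChange K).torsionLocalKer (v₁.adicCompletion K) ((p ^ 1 : ℕ) : ℤ) ↔
        κ m (insert q₂ (insert q₁ n)) ∈ (W.baseChange K).torsionLocalKer (v₂.adicCompletion K) ((p ^ 1 : ℕ) : ℤ)))
    (hbase : q₂ ∉ baseLocusQP W K p κ (insert q₂ (insert q₁ n))) : ∃ m, κ m n ≠ 0 := by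
  -- `q₂` off the base locus: some class two levels up is not locally trivial at a place above `q₂`
  obtain ⟨m, v₂, hv₂, htop⟩ := (not_mem_baseLocusQP_iff W K p).mp hbase
  -- a place above `q₁`, where the bottom class is then not locally trivial either
  obtain ⟨v₁, hv₁⟩ :=
    Literature.NumberTheory.NumberFields.RingOfIntegers.exists_heightOneSpectrum_natCast_mem K q₁.2.1
  exact ⟨m, ne_zero_of_not_mem_torsionLocalKer W K p fun h ↦ htop ((hrec m v₁ v₂ hv₁ hv₂).mp h)⟩

/-! ## §2 `baseCase` from rank lowering (A1) and the first floor -/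

variable (c : K ≃ₐ[ℚ] K) [W.IsElliptic] [Fact p.Prime] [Module (ZMod p) (Vp W K p)]

/-- **(A5) BASE CASE from (A1) and the FIRST FLOOR** — W. Zhang's proof of Thm 7.2 (pp. 232–234) run at a level `n` of
canonical rank one, with its definite-side half as ONE hypothesis. Given (A1) RANK LOWERING in the landed shape (every non-zero
`x ∈ Sel_n^μ` is killed at some new admissible `q ∉ n` with `dim Sel_{n∪q}^μ = dim Sel_n^μ − 1` and `Sel_{n∪q}^{¬μ} = Sel_n^{¬μ}`;
W. Zhang Prop. 5.4 + Lemma 7.3) and, for the class `y` (meant: `c(1, n) = κ(∅, n)`), the FIRST FLOOR at level `n` (for every new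
admissible `q ∉ n`: `Sel_{n∪q}^+ = 0 ∧ Sel_{n∪q}^- = 0 ⟹ loc_v y ≠ 0` at the places `v ∣ q` — Thm 7.1 rank-0 anchor for the
level-raised form `g_{nq}` + Cor. 6.2 ∕ Thm. 6.4 Gross formula and period comparison + Thm. 6.5 first reciprocity law): if the
canonical spaces at level `n` have total dimension one, then `y ≠ 0`. Proof: the line `Sel_n^μ = ⟨x⟩`, the other sign trivial;
(A1) kills `x` at some `q`, so BOTH `Sel_{n∪q}^{±} = 0`; the first floor makes `y` locally non-trivial above `q`, hence non-zero.
[cite: WZhang2014, Thm. 7.2 (proof, pp. 232–234), Prop. 5.4, Lemma 7.3, Thm. 7.1, Cor. 6.2, Thm. 6.4, Thm. 6.5] -/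
theorem ne_zero_of_rankLowering_of_firstFloor
    (hA1 : ∀ (n : Finset (AdmQ W K p)) (μ : Bool) (x : Vp W K p), x ∈ SelQP W K p c n μ → x ≠ 0 →
      ∃ q : AdmQ W K p, q ∉ n ∧ x ∉ SelQP W K p c (insert q n) μ ∧
        SelQP W K p c (insert q n) μ ≤ SelQP W K p c n μ ∧
        finrank (ZMod p) (SelQP W K p c (insert q n) μ) + 1 = finrank (ZMod p) (SelQP W K p c n μ) ∧
        SelQP W K p c (insert q n) (!μ) = SelQP W K p c n (!μ))
    {n : Finset (AdmQ W K p)} {y : Vp W K p}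
    (hFF : ∀ q : AdmQ W K p, q ∉ n → SelQP W K p c (insert q n) true = ⊥ → SelQP W K p c (insert q n) false = ⊥ →
      ∀ v : HeightOneSpectrum (𝓞 K), ((q : ℕ) : 𝓞 K) ∈ v.asIdeal →
      y ∉ (W.baseChange K).torsionLocalKer (v.adicCompletion K) ((p ^ 1 : ℕ) : ℤ))
    (h1 : finrank (ZMod p) (SelQP W K p c n true) + finrank (ZMod p) (SelQP W K p c n false) = 1) : y ≠ 0 := by
  -- the sign `μ` carrying the line, the other sign trivial
  obtain ⟨μ, hμ1, hμ0⟩ : ∃ μ : Bool, finrank (ZMod p) (SelQP W K p c n μ) = 1 ∧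
      finrank (ZMod p) (SelQP W K p c n (!μ)) = 0 := by
    rcases Nat.eq_zero_or_pos (finrank (ZMod p) (SelQP W K p c n true)) with h | h
    · exact ⟨false, by omega, h⟩
    · exact ⟨true, by omega, by change finrank (ZMod p) (SelQP W K p c n false) = 0; omega⟩
  -- a generator `x` of the line
  obtain ⟨⟨x, hxmem⟩, hx0, -⟩ := finrank_eq_one_iff'.mp hμ1
  have hx0' : x ≠ 0 := fun h ↦ hx0 (Subtype.ext h)
  -- (A1): a new admissible `q` killing `x`; then both canonical spaces at level `n ∪ {q}` vanish
  obtain ⟨q, hqn, -, -, hfin, hneg⟩ := hA1 n μ x hxmem hx0'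
  haveI := finiteDimensional_selQP W K p c (insert q n) μ
  haveI := finiteDimensional_selQP W K p c n (!μ)
  have hμ' : SelQP W K p c (insert q n) μ = ⊥ := Submodule.finrank_eq_zero.mp (by omega)
  have hneg' : SelQP W K p c (insert q n) (!μ) = ⊥ := by
    rw [hneg]
    exact Submodule.finrank_eq_zero.mp hμ0
  have htrue : SelQP W K p c (insert q n) true = ⊥ := by
    cases μ
    · exact hneg'
    · exact hμ'
  have hfalse : SelQP W K p c (insert q n) false = ⊥ := by
    cases μ
    · exact hμ'
    · exact hneg'
  -- the first floor at `(n, q)`: `y` is not locally trivial above `q`, hence non-zero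
  obtain ⟨v, hv⟩ :=
    Literature.NumberTheory.NumberFields.RingOfIntegers.exists_heightOneSpectrum_natCast_mem K q.2.1
  exact ne_zero_of_not_mem_torsionLocalKer W K p (hFF q hqn htrue hfalse v hv)

/-! ## §3 The dictionary: a level Kolyvagin system from even-level classes, (SRL) and (FF) at a ♯ additive frame -/

variable [NeZero (W.conductorNorm ℤ)] (Dt : ModularParametrizationData W (W.conductorNorm ℤ)) (β : ℤ) (ι : K →+* ℂ)

/-- **KS′ AT A FRAME FROM ZHANG-SHAPE INPUTS.** At a ♯ additive frame (`p ≥ 5`, `Addv W p`, `ρ̄_{E,p}` onto, ♠(1) `p ∤ v_ℓ(Δ)`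
at multiplicative `ℓ`, ♠(2) two multiplicative primes, `p ∤ ∏ c_ℓ`, `r_an = 1`, `K` imaginary quadratic with odd `d_K`, Heegner
for `N_E`, `L(E^{(d_K)}, 1) ≠ 0`, `4N ∣ β² − d_K`, `p ∤ c_Manin`) and for complex conjugation `c ≠ 1`, SUPPOSE GIVEN:
EVEN-level classes `κ₀(m, n) ∈ H¹(K, E[p])` and signs `ε₀ n` (Heegner classes on the Shimura curves `X_{N, ∏n}`, `#n` even)
with the `realisation` identity at level `∅` and the Kolyvagin-system properties `sign` ∕ `selmer_off` ∕ `selmer_inf` ∕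
`toric_on` ∕ `transverse_on` ∕ `relation` at even non-empty levels (§8.1 property (1), (8.1)); (SRL) the SECOND RECIPROCITY LAW
in congruence form from even bottom levels (Thm 4.3: `loc_{v₁} κ₀(m, n) = 0 ⟺ loc_{v₂} κ₀(m, n ∪ {q₁,q₂}) = 0`); (FF) the FIRST
FLOOR at even non-empty levels (`Sel_{n∪q}^{±} = 0 ⟹ loc_v κ₀(∅, n) ≠ 0`, `v ∣ q`: Thm 7.1 + Cor 6.2 ∕ Thm 6.4 + Thm 6.5 for
the level-raised form `g_{nq}`). THEN a `LevelKolyvaginSystemP W K p Dt β ι c` exists — the conclusion of the crux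
`LevelKolyvaginSystemsAdditive` at the frame. `transport` is (SRL) (`exists_ne_zero_of_reciprocity_of_notMem_baseLocusQP`),
`baseCase` is (FF) + the LANDED (A1) `stub_rankLoweringAdditive` (`ne_zero_of_rankLowering_of_firstFloor`), odd levels carry
the zero classes (`nonempty_levelKolyvaginSystemP_of_evenLevels`). In print for `p ∤ N` (W. Zhang 2014); at `p² ∣ N` (SRL)'s
multiplicity-one input and (FF)'s anchor ∕ period bridge are the route's open (γ) ∕ (δ). CONDITIONAL; closes nothing.
[cite: WZhang2014, Thm. 4.3, Prop. 5.4, Thm. 6.5, Thm. 7.1, Thm. 7.2, Lemma 7.3, §8.1, §9] [cite: BertoliniDarmon2005,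
Thm. 3.2, Thm. 9.2] -/
theorem nonempty_levelKolyvaginSystemP_of_reciprocity_of_firstFloor
    (h5 : 5 ≤ p) (hadd : Addv W p) (hsurj : W.HasSurjectiveModNGaloisRep p)
    (hsp : ∀ (ℓ : ℕ) [Fact ℓ.Prime], W.HasMultiplicativeReductionAtPrime ℓ →
      ¬ p ∣ padicValInt ℓ W.minimalDiscriminantInt)
    (htwo : ∃ (ℓ₁ ℓ₂ : ℕ) (_ : Fact ℓ₁.Prime) (_ : Fact ℓ₂.Prime), ℓ₁ ≠ ℓ₂ ∧
      W.HasMultiplicativeReductionAtPrime ℓ₁ ∧ W.HasMultiplicativeReductionAtPrime ℓ₂)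
    (htam : ¬ p ∣ W.tamagawaProduct) (hr : W.analyticRank = 1)
    (hK : IsImaginaryQuadratic K) (hodd : Odd (NumberField.discr K))
    (hH : SatisfiesHeegnerHypothesis (W.conductorNorm ℤ) K)
    (hL : (W.quadraticTwist (NumberField.discr K : ℚ)).entireLFunction 1 ≠ 0)
    (hβ : (4 * (W.conductorNorm ℤ : ℤ)) ∣ β ^ 2 - NumberField.discr K) (hcM : ¬ (p : ℤ) ∣ Dt.c) (hc1 : c ≠ 1)
    (ε₀ : Finset (AdmQ W K p) → Bool)
    (κ₀ : Finset {ℓ // Zhang2014.IsKolyvaginPrime (W.conductorNorm ℤ) W K p ℓ} → Finset (AdmQ W K p) → Vp W K p)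
    (realisation : ∀ m : Finset {ℓ // Zhang2014.IsKolyvaginPrime (W.conductorNorm ℤ) W K p ℓ},
      ∃ d : KolyvaginHeegnerData Dt β ι (∏ ℓ ∈ m, (ℓ : ℕ)), κ₀ m ∅ = d.kolyvaginClass (Fact.out : p.Prime) 1)
    (sign : ∀ n : Finset (AdmQ W K p), n.Nonempty → Even n.card →
      ∀ m : Finset {ℓ // Zhang2014.IsKolyvaginPrime (W.conductorNorm ℤ) W K p ℓ},
      conjAct W c ((p ^ 1 : ℕ) : ℤ) (κ₀ m n) = sgnP (ε₀ n ^^ Nat.bodd m.card) • κ₀ m n)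
    (selmer_off : ∀ n : Finset (AdmQ W K p), n.Nonempty → Even n.card →
      ∀ (m : Finset {ℓ // Zhang2014.IsKolyvaginPrime (W.conductorNorm ℤ) W K p ℓ}) (v : HeightOneSpectrum (𝓞 K)),
      (∀ ℓ ∈ m, ((ℓ : ℕ) : 𝓞 K) ∉ v.asIdeal) → (∀ q ∈ n, ((q : ℕ) : 𝓞 K) ∉ v.asIdeal) →
      κ₀ m n ∈ selmerLocalKer (W.baseChange K) (v.adicCompletion K) ((p ^ 1 : ℕ) : ℤ))
    (selmer_inf : ∀ n : Finset (AdmQ W K p), n.Nonempty → Even n.card →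
      ∀ (m : Finset {ℓ // Zhang2014.IsKolyvaginPrime (W.conductorNorm ℤ) W K p ℓ}) (w : InfinitePlace K),
      κ₀ m n ∈ selmerLocalKer (W.baseChange K) w.Completion ((p ^ 1 : ℕ) : ℤ))
    (toric_on : ∀ n : Finset (AdmQ W K p), n.Nonempty → Even n.card →
      ∀ m : Finset {ℓ // Zhang2014.IsKolyvaginPrime (W.conductorNorm ℤ) W K p ℓ}, ∀ q ∈ n,
      ∀ v : HeightOneSpectrum (𝓞 K),
      ((q : ℕ) : 𝓞 K) ∈ v.asIdeal → κ₀ m n ∈ toricLocalKer (W.baseChange K) (v.adicCompletion K) ((p ^ 1 : ℕ) : ℤ))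
    (transverse_on : ∀ n : Finset (AdmQ W K p), n.Nonempty → Even n.card →
      ∀ m : Finset {ℓ // Zhang2014.IsKolyvaginPrime (W.conductorNorm ℤ) W K p ℓ}, ∀ ℓ ∈ m,
      ∀ v : HeightOneSpectrum (𝓞 K),
      ((ℓ : ℕ) : 𝓞 K) ∈ v.asIdeal → κ₀ m n ∈ transverseLocalKerP W K p ι ℓ v)
    (relation : ∀ n : Finset (AdmQ W K p), n.Nonempty → Even n.card →
      ∀ (m : Finset {ℓ // Zhang2014.IsKolyvaginPrime (W.conductorNorm ℤ) W K p ℓ})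
        (ℓ : {ℓ // Zhang2014.IsKolyvaginPrime (W.conductorNorm ℤ) W K p ℓ}), ℓ ∉ m → ∀ v : HeightOneSpectrum (𝓞 K),
      ((ℓ : ℕ) : 𝓞 K) ∈ v.asIdeal →
      (κ₀ (insert ℓ m) n ∈ (W.baseChange K).torsionLocalKer (v.adicCompletion K) ((p ^ 1 : ℕ) : ℤ) ↔
        κ₀ m n ∈ (W.baseChange K).torsionLocalKer (v.adicCompletion K) ((p ^ 1 : ℕ) : ℤ)))
    (reciprocity : ∀ (n : Finset (AdmQ W K p)) (q₁ q₂ : AdmQ W K p), q₁ ∉ n → q₂ ∉ insert q₁ n → Even n.card →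
      ∀ (m : Finset {ℓ // Zhang2014.IsKolyvaginPrime (W.conductorNorm ℤ) W K p ℓ}) (v₁ v₂ : HeightOneSpectrum (𝓞 K)),
      ((q₁ : ℕ) : 𝓞 K) ∈ v₁.asIdeal → ((q₂ : ℕ) : 𝓞 K) ∈ v₂.asIdeal →
      (κ₀ m n ∈ (W.baseChange K).torsionLocalKer (v₁.adicCompletion K) ((p ^ 1 : ℕ) : ℤ) ↔
        κ₀ m (insert q₂ (insert q₁ n)) ∈ (W.baseChange K).torsionLocalKer (v₂.adicCompletion K) ((p ^ 1 : ℕ) : ℤ)))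
    (firstFloor : ∀ n : Finset (AdmQ W K p), n.Nonempty → Even n.card →
      ∀ q : AdmQ W K p, q ∉ n → SelQP W K p c (insert q n) true = ⊥ → SelQP W K p c (insert q n) false = ⊥ →
      ∀ v : HeightOneSpectrum (𝓞 K), ((q : ℕ) : 𝓞 K) ∈ v.asIdeal →
      κ₀ ∅ n ∉ (W.baseChange K).torsionLocalKer (v.adicCompletion K) ((p ^ 1 : ℕ) : ℤ)) :
    Nonempty (LevelKolyvaginSystemP W K p Dt β ι c) := by
  -- (A1) at the frame, LANDED
  have hA1 := stub_rankLoweringAdditive W p K Dt β ι h5 hadd hsurj hsp htwo htam hr hK hodd hH hL hβ hcM c hc1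
  refine nonempty_levelKolyvaginSystemP_of_evenLevels W K p c Dt β ι ε₀ κ₀ realisation sign selmer_off selmer_inf
    toric_on transverse_on relation ?_ ?_
  · -- transport (A2) from (SRL)
    intro n q₁ q₂ hq₁ hq₂ he hbase
    exact exists_ne_zero_of_reciprocity_of_notMem_baseLocusQP W K p κ₀ (reciprocity n q₁ q₂ hq₁ hq₂ he) hbase
  · -- base case (A5) from (A1) + (FF)
    intro n hne he h1
    exact ne_zero_of_rankLowering_of_firstFloor W K p c hA1 (firstFloor n hne he) h1

end Summit.BirchSwinnertonDyer.BirchSwinnertonDyer.Theorems.AdditiveKoly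

/-! # Appendix (width seat w3, appended 2026-08-27): the converse of the first floor and the transport-agnostic assembly -/

namespace Summit.BirchSwinnertonDyer.BirchSwinnertonDyer.Theorems.AdditiveKoly

open WeierstrassCurve NumberField IsDedekindDomain
  Literature.NumberTheory.EllipticCurves Literature.NumberTheory.EllipticCurves.ModularForms
  Literature.NumberTheory.EllipticCurves.Rank1Residual Literature.NumberTheory.GaloisRepresentations Module
  Summit.BirchSwinnertonDyer.Rank1Residual.X11b.Three.Koly

variable (W : WeierstrassCurve ℚ) (K : Type) [Field K] [NumberField K] (p : ℕ) [W.IsGloballyMinimal] (c : K ≃ₐ[ℚ] K)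
  [Module (ZMod p) (Vp W K p)]

/-! ## §4 (appended) The first floor is NOT over-strong: at the levels where `baseCase` bites, (FF) ⟺ `c(1, n) ≠ 0` -/

section Converse

/-- **(FF) from non-vanishing** — the converse direction, E-side and elementary: a NON-ZERO class `y` of the canonical
space `Sel_n^ε` is NOT locally trivial above any new admissible `q ∉ n` whose level-`(n ∪ {q})` space of the same sign
vanishes (were `loc_v y = 0` at the place `v ∣ q` — the only one, `q` being inert — `y` would be toric above `q`, hence a
class of `Sel_{n∪q}^ε = 0`). So at an even level `n` carrying `κ(∅, n) ∈ Sel_n^{ε₀ n}` (property (1)), the first-floor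
schema (FF)_n FOLLOWS from `κ(∅, n) ≠ 0`: (FF) asks nothing beyond W. Zhang's Thm 7.2 conclusion at the levels where the
induction uses it (with `ne_zero_of_rankLowering_of_firstFloor`: (FF)_n ⟺ `κ(∅,n) ≠ 0` at canonical rank one).
[cite: WZhang2014, Thm. 7.2, Prop. 5.4, §9 (9.3)] -/
theorem not_mem_torsionLocalKer_of_ne_zero_of_selQP_insert_eq_bot {n : Finset (AdmQ W K p)} {ε : Bool}
    {y : Vp W K p} (hy : y ∈ SelQP W K p c n ε) (hy0 : y ≠ 0) {q : AdmQ W K p} (hqn : q ∉ n)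
    (hbot : SelQP W K p c (insert q n) ε = ⊥) (v : HeightOneSpectrum (𝓞 K)) (hv : ((q : ℕ) : 𝓞 K) ∈ v.asIdeal) :
    y ∉ (W.baseChange K).torsionLocalKer (v.adicCompletion K) ((p ^ 1 : ℕ) : ℤ) := by
  intro hloc
  -- the place above the inert `q` is unique
  have huniq : ∀ w : HeightOneSpectrum (𝓞 K), ((q : ℕ) : 𝓞 K) ∈ w.asIdeal → w = v := by
    have hqP : (Ideal.span {((q : ℕ) : 𝓞 K)}).IsPrime := q.2.2.2.1
    have hspan : ∀ w : HeightOneSpectrum (𝓞 K), ((q : ℕ) : 𝓞 K) ∈ w.asIdeal →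
        w.asIdeal = Ideal.span {((q : ℕ) : 𝓞 K)} := fun w hw ↦ by
      have hle : Ideal.span {((q : ℕ) : 𝓞 K)} ≤ w.asIdeal := by
        rw [Ideal.span_le, Set.singleton_subset_iff]; exact hw
      have hne : Ideal.span {((q : ℕ) : 𝓞 K)} ≠ ⊥ := by
        rw [Ne, Ideal.span_singleton_eq_bot]; exact_mod_cast q.2.1.ne_zero
      exact ((hqP.isMaximal hne).eq_of_le w.isPrime.ne_top hle).symm
    intro w hw
    exact HeightOneSpectrum.ext (by rw [hspan v hv, hspan w hw])
  -- `y` is a class of `Sel_{n ∪ {q}}^ε`: the old conditions, plus TORIC above `q` by local triviality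
  obtain ⟨hsgn, hinf, hfin, htor⟩ := (mem_selQP_iff W K p c n ε y).mp hy
  have hy' : y ∈ SelQP W K p c (insert q n) ε := by
    refine (mem_selQP_iff W K p c (insert q n) ε y).mpr ⟨hsgn, hinf, fun w hw ↦ hfin w fun q' hq' ↦ hw q'
      (Finset.mem_insert_of_mem hq'), fun q' hq' w hw ↦ ?_⟩
    rcases Finset.mem_insert.mp hq' with rfl | hq'
    · -- a locally trivial class is toric (the zero cocycle is valued in the augmentation line); akr-p1 g0's
      -- `torsionLocalKer_le_toricLocalKer`, inlined to stay out of the route file's import cone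
      rw [huniq w hw]
      change (W.baseChange K).torsionLocMap (v.adicCompletion K) ((p ^ 1 : ℕ) : ℤ) y = 0 at hloc
      change y ∈ AddSubgroup.comap _ _
      rw [AddSubgroup.mem_comap, hloc]
      exact AddSubgroup.zero_mem _
    · exact htor q' hq' w hw
  rw [hbot, Submodule.mem_bot] at hy'
  exact hy0 hy'

variable [W.IsElliptic] [Fact p.Prime]

/-- **At canonical rank one, (FF)_n ⟺ `y ≠ 0`** for a class `y ∈ Sel_n^ε` (meant: `y = κ(∅, n)`, `ε = ε₀ n`), granted (A1)
in its landed shape: the first floor at level `n` for `y` holds iff `y ≠ 0`. (⟸: the previous theorem, for which the sign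
`!ε` plays no role; ⟹: `ne_zero_of_rankLowering_of_firstFloor`.) The open input of KS′ carried by `baseCase` is therefore
EXACTLY W. Zhang's Thm 7.2 conclusion for the level-raised forms, neither more nor less. [cite: WZhang2014, Thm. 7.2] -/
theorem firstFloor_iff_ne_zero_of_rankOne
    (hA1 : ∀ (n : Finset (AdmQ W K p)) (μ : Bool) (x : Vp W K p), x ∈ SelQP W K p c n μ → x ≠ 0 →
      ∃ q : AdmQ W K p, q ∉ n ∧ x ∉ SelQP W K p c (insert q n) μ ∧
        SelQP W K p c (insert q n) μ ≤ SelQP W K p c n μ ∧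
        finrank (ZMod p) (SelQP W K p c (insert q n) μ) + 1 = finrank (ZMod p) (SelQP W K p c n μ) ∧
        SelQP W K p c (insert q n) (!μ) = SelQP W K p c n (!μ))
    {n : Finset (AdmQ W K p)} {ε : Bool} {y : Vp W K p} (hy : y ∈ SelQP W K p c n ε)
    (h1 : finrank (ZMod p) (SelQP W K p c n true) + finrank (ZMod p) (SelQP W K p c n false) = 1) :
    (∀ q : AdmQ W K p, q ∉ n → SelQP W K p c (insert q n) true = ⊥ → SelQP W K p c (insert q n) false = ⊥ →
      ∀ v : HeightOneSpectrum (𝓞 K), ((q : ℕ) : 𝓞 K) ∈ v.asIdeal →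
      y ∉ (W.baseChange K).torsionLocalKer (v.adicCompletion K) ((p ^ 1 : ℕ) : ℤ)) ↔ y ≠ 0 := by
  refine ⟨fun hFF ↦ ne_zero_of_rankLowering_of_firstFloor W K p c hA1 hFF h1, fun hy0 q hqn htrue hfalse v hv ↦ ?_⟩
  have hbot : SelQP W K p c (insert q n) ε = ⊥ := by
    cases ε
    · exact hfalse
    · exact htrue
  exact not_mem_torsionLocalKer_of_ne_zero_of_selQP_insert_eq_bot W K p c hy hy0 hqn hbot v hv

end Converse

/-! ## §5 (appended) Transport-agnostic assembly: even-level classes + ANY transport certificate + (FF) -/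

variable [W.IsElliptic] [Fact p.Prime] [NeZero (W.conductorNorm ℤ)]
  (Dt : ModularParametrizationData W (W.conductorNorm ℤ)) (β : ℤ) (ι : K →+* ℂ)

/-- **A level Kolyvagin system from even-level classes, an arbitrary TRANSPORT certificate and the FIRST FLOOR** at a
♯ additive frame: the hypotheses of `nonempty_levelKolyvaginSystemP_of_evenLevels` with its `baseCase` REPLACED by the
first floor (FF) (the base case being then supplied by the LANDED (A1) `stub_rankLoweringAdditive` through
`ne_zero_of_rankLowering_of_firstFloor`). The `transport` binder is the field's own text at even bottom levels, so that
either producer shape composes through this one lemma: the congruence form (`exists_ne_zero_of_reciprocity_of_notMem_baseLocusQP`,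
this file) or the bipartite form (`transport_of_reciprocityLaws`, width seat w2). CONDITIONAL; closes nothing.
[cite: WZhang2014, Thm. 4.3, Prop. 5.4, Thm. 7.2, Lemma 7.3, §9] -/
theorem nonempty_levelKolyvaginSystemP_of_transport_of_firstFloor
    (h5 : 5 ≤ p) (hadd : Addv W p) (hsurj : W.HasSurjectiveModNGaloisRep p)
    (hsp : ∀ (ℓ : ℕ) [Fact ℓ.Prime], W.HasMultiplicativeReductionAtPrime ℓ →
      ¬ p ∣ padicValInt ℓ W.minimalDiscriminantInt)
    (htwo : ∃ (ℓ₁ ℓ₂ : ℕ) (_ : Fact ℓ₁.Prime) (_ : Fact ℓ₂.Prime), ℓ₁ ≠ ℓ₂ ∧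
      W.HasMultiplicativeReductionAtPrime ℓ₁ ∧ W.HasMultiplicativeReductionAtPrime ℓ₂)
    (htam : ¬ p ∣ W.tamagawaProduct) (hr : W.analyticRank = 1)
    (hK : IsImaginaryQuadratic K) (hodd : Odd (NumberField.discr K))
    (hH : SatisfiesHeegnerHypothesis (W.conductorNorm ℤ) K)
    (hL : (W.quadraticTwist (NumberField.discr K : ℚ)).entireLFunction 1 ≠ 0)
    (hβ : (4 * (W.conductorNorm ℤ : ℤ)) ∣ β ^ 2 - NumberField.discr K) (hcM : ¬ (p : ℤ) ∣ Dt.c) (hc1 : c ≠ 1)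
    (ε₀ : Finset (AdmQ W K p) → Bool)
    (κ₀ : Finset {ℓ // Zhang2014.IsKolyvaginPrime (W.conductorNorm ℤ) W K p ℓ} → Finset (AdmQ W K p) → Vp W K p)
    (realisation : ∀ m : Finset {ℓ // Zhang2014.IsKolyvaginPrime (W.conductorNorm ℤ) W K p ℓ},
      ∃ d : KolyvaginHeegnerData Dt β ι (∏ ℓ ∈ m, (ℓ : ℕ)), κ₀ m ∅ = d.kolyvaginClass (Fact.out : p.Prime) 1)
    (sign : ∀ n : Finset (AdmQ W K p), n.Nonempty → Even n.card →
      ∀ m : Finset {ℓ // Zhang2014.IsKolyvaginPrime (W.conductorNorm ℤ) W K p ℓ},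
      conjAct W c ((p ^ 1 : ℕ) : ℤ) (κ₀ m n) = sgnP (ε₀ n ^^ Nat.bodd m.card) • κ₀ m n)
    (selmer_off : ∀ n : Finset (AdmQ W K p), n.Nonempty → Even n.card →
      ∀ (m : Finset {ℓ // Zhang2014.IsKolyvaginPrime (W.conductorNorm ℤ) W K p ℓ}) (v : HeightOneSpectrum (𝓞 K)),
      (∀ ℓ ∈ m, ((ℓ : ℕ) : 𝓞 K) ∉ v.asIdeal) → (∀ q ∈ n, ((q : ℕ) : 𝓞 K) ∉ v.asIdeal) →
      κ₀ m n ∈ selmerLocalKer (W.baseChange K) (v.adicCompletion K) ((p ^ 1 : ℕ) : ℤ))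
    (selmer_inf : ∀ n : Finset (AdmQ W K p), n.Nonempty → Even n.card →
      ∀ (m : Finset {ℓ // Zhang2014.IsKolyvaginPrime (W.conductorNorm ℤ) W K p ℓ}) (w : InfinitePlace K),
      κ₀ m n ∈ selmerLocalKer (W.baseChange K) w.Completion ((p ^ 1 : ℕ) : ℤ))
    (toric_on : ∀ n : Finset (AdmQ W K p), n.Nonempty → Even n.card →
      ∀ m : Finset {ℓ // Zhang2014.IsKolyvaginPrime (W.conductorNorm ℤ) W K p ℓ}, ∀ q ∈ n,
      ∀ v : HeightOneSpectrum (𝓞 K),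
      ((q : ℕ) : 𝓞 K) ∈ v.asIdeal → κ₀ m n ∈ toricLocalKer (W.baseChange K) (v.adicCompletion K) ((p ^ 1 : ℕ) : ℤ))
    (transverse_on : ∀ n : Finset (AdmQ W K p), n.Nonempty → Even n.card →
      ∀ m : Finset {ℓ // Zhang2014.IsKolyvaginPrime (W.conductorNorm ℤ) W K p ℓ}, ∀ ℓ ∈ m,
      ∀ v : HeightOneSpectrum (𝓞 K),
      ((ℓ : ℕ) : 𝓞 K) ∈ v.asIdeal → κ₀ m n ∈ transverseLocalKerP W K p ι ℓ v)
    (relation : ∀ n : Finset (AdmQ W K p), n.Nonempty → Even n.card →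
      ∀ (m : Finset {ℓ // Zhang2014.IsKolyvaginPrime (W.conductorNorm ℤ) W K p ℓ})
        (ℓ : {ℓ // Zhang2014.IsKolyvaginPrime (W.conductorNorm ℤ) W K p ℓ}), ℓ ∉ m → ∀ v : HeightOneSpectrum (𝓞 K),
      ((ℓ : ℕ) : 𝓞 K) ∈ v.asIdeal →
      (κ₀ (insert ℓ m) n ∈ (W.baseChange K).torsionLocalKer (v.adicCompletion K) ((p ^ 1 : ℕ) : ℤ) ↔
        κ₀ m n ∈ (W.baseChange K).torsionLocalKer (v.adicCompletion K) ((p ^ 1 : ℕ) : ℤ)))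
    (transport : ∀ (n : Finset (AdmQ W K p)) (q₁ q₂ : AdmQ W K p), q₁ ∉ n → q₂ ∉ insert q₁ n → Even n.card →
      q₂ ∉ baseLocusQP W K p κ₀ (insert q₂ (insert q₁ n)) → ∃ m, κ₀ m n ≠ 0)
    (firstFloor : ∀ n : Finset (AdmQ W K p), n.Nonempty → Even n.card →
      ∀ q : AdmQ W K p, q ∉ n → SelQP W K p c (insert q n) true = ⊥ → SelQP W K p c (insert q n) false = ⊥ →
      ∀ v : HeightOneSpectrum (𝓞 K), ((q : ℕ) : 𝓞 K) ∈ v.asIdeal →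
      κ₀ ∅ n ∉ (W.baseChange K).torsionLocalKer (v.adicCompletion K) ((p ^ 1 : ℕ) : ℤ)) :
    Nonempty (LevelKolyvaginSystemP W K p Dt β ι c) := by
  have hA1 := stub_rankLoweringAdditive W p K Dt β ι h5 hadd hsurj hsp htwo htam hr hK hodd hH hL hβ hcM c hc1
  exact nonempty_levelKolyvaginSystemP_of_evenLevels W K p c Dt β ι ε₀ κ₀ realisation sign selmer_off selmer_inf
    toric_on transverse_on relation transport
    fun n hne he h1 ↦ ne_zero_of_rankLowering_of_firstFloor W K p c hA1 (firstFloor n hne he) h1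

end Summit.BirchSwinnertonDyer.BirchSwinnertonDyer.Theorems.AdditiveKoly

end
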